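import Summits.RiemannHypothesis.RiemannHypothesis.Theorems.WeilGroundStateGroundStatesConvergeToXiPhiTail
import Summits.RiemannHypothesis.RiemannHypothesis.Theorems.WeilGroundStateGroundStatesConvergeToXiEnergyUpperTail
import Summits.RiemannHypothesis.RiemannHypothesis.Theorems.WeilGroundStateGroundStatesConvergeToXiStubMellinXi
import Summits.RiemannHypothesis.RiemannHypothesis.Theorems.WeilGroundStateGroundStatesConvergeToXiStubPsiDecay
import Literature.NumberTheory.LFunctions.WeilExplicit
import Literature.NumberTheory.LFunctions.WeilExplicitProofs
import Literature.NumberTheory.LFunctions.WeilExplicitFormulaProofs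
import Literature.NumberTheory.LFunctions.WeilMellinBounds
import Literature.NumberTheory.LFunctions.WeilGroundStateRealZerosProofs
import Literature.NumberTheory.LFunctions.RiemannXi
import Mathlib.Analysis.Convolution
import Mathlib.MeasureTheory.Group.Integral
import HarnessLib

/-!
# `WeilGroundState.GroundStatesConvergeToXi` — Riemann's kernel is Weil-harmonic: `W(Φ ⋆ g̃) = 0`
(crux item stmt-RiemannHypothesis-1527, route route-RiemannHypothesis-WeilGroundState; line `Sketch`,
stub `stub_phi_conv_harmonic` (W14); `--supports`)

With `Φ(t) = 2Ψ(2t)` Riemann's kernel (`LagariasMontague.Psic`; `Φ̂ = weilMellin Φ = ξ` by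
`stub_mellinXi`) and `g` a Weil test function, `F = Φ ⋆ g̃` (`g̃ = weilReflect g`) lies in the
exponential Weil class with rate `1`:
* it is smooth (`HasCompactSupport.contDiff_convolution_right`), with `F' = Φ ⋆ g̃'`,
  `F'' = Φ ⋆ g̃''` (`HasCompactSupport.hasDerivAt_convolution_right`);
* for every continuous `k` supported in `[-A, A]`,
  `‖(Φ ⋆ k)(t)‖ ≤ ∫ ‖Φ(u)‖ ‖k(t-u)‖ du ≤ K e^{A} e^{-|t|} ∫ ‖k‖`, since on the support
  `|t - u| ≤ A` and `‖Φ(u)‖ ≤ K e^{-|u|} ≤ K e^{A - |t|}` (envelope of `…PhiTail`).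
Its transform is `F̂(s) = Φ̂(s) ĥ(s) = ξ(s) · conj ĝ(1 - conj s)` for every `s` (write
`e^{ct} = e^{cu} e^{c(t-u)}` and apply `MeasureTheory.integral_convolution` to the integrable pair
`Φ e^{c·}`, `g̃ e^{c·}`; `weilMellin_weilReflect_holds`), which vanishes at every non-trivial zero
of `ζ`; hence, GIVEN the explicit formula for the exponential class `Σ'_ρ m(ρ) f̂(ρ) = W(f)`
(hypothesis), `W(Φ ⋆ g̃) = Σ'_ρ 0 = 0`.

No new definitions; no named fact is used.
-/

noncomputable section

set_option linter.dupNamespace false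

open scoped Topology Real ComplexConjugate Convolution
open Filter Set MeasureTheory Complex

namespace Summit.RiemannHypothesis.RiemannHypothesis.Theorems.GroundStatesConvergeToXi

open Literature.NumberTheory.LFunctions

/-! ## Rate-`1` bound of `Φ ⋆ k` for a compactly supported continuous `k` -/

/-- `‖Φ(u)‖ ≤ K e^{-|u|}`: the double-exponential envelope `exp(|u|/2 − (π/4)e^{2|u|})` of
`…PhiTail` is `≤ e^{-|u|}`, since `e^{2|u|} ≥ 1 + 2|u|` and `π > 3` give `(π/4)e^{2|u|} ≥ (3/2)|u|`.
[folklore] -/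
theorem phiConv_exists_norm_phi_le_exp_neg :
    ∃ K : ℝ, 0 ≤ K ∧ ∀ u : ℝ,
      ‖(2 : ℂ) * LagariasMontague.Psic (2 * u)‖ ≤ K * Real.exp (-|u|) := by
  obtain ⟨K, hK, h⟩ := exists_norm_phi_le
  refine ⟨K, hK, fun u => (h u).trans (mul_le_mul_of_nonneg_left ?_ hK)⟩
  rw [Real.exp_le_exp]
  have hE : π / 4 * (2 * |u| + 1) ≤ π / 4 * Real.exp (2 * |u|) :=
    mul_le_mul_of_nonneg_left (Real.add_one_le_exp (2 * |u|)) (by positivity)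
  have hπ : 0 ≤ (π / 2 - 3 / 2) * |u| :=
    mul_nonneg (by linarith [Real.pi_gt_three]) (abs_nonneg u)
  nlinarith [Real.pi_pos]

/-- **Class bound of `Φ ⋆ k`.** For a continuous compactly supported `k` (support in `[-A, A]`),
`‖(Φ ⋆ k)(t)‖ ≤ (K e^{|A|} ∫ ‖k‖) e^{-|t|}`: on the support of `u ↦ k(t - u)` one has
`|t| - |u| ≤ |t - u| ≤ A`, so `‖Φ(u)‖ ≤ K e^{-|u|} ≤ K e^{|A|} e^{-|t|}`. [folklore] -/
theorem phiConv_norm_weilConv_le {k : ℝ → ℂ} (hk : Continuous k) (hk' : HasCompactSupport k) :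
    ∃ C : ℝ, 0 ≤ C ∧ ∀ t : ℝ,
      ‖weilConv (fun t : ℝ => (2 : ℂ) * LagariasMontague.Psic (2 * t)) k t‖ ≤
        C * Real.exp (-(1 * |t|)) := by
  obtain ⟨K, hK, hΦ⟩ := phiConv_exists_norm_phi_le_exp_neg
  obtain ⟨A, hA⟩ := hk'.isCompact.isBounded.subset_closedBall 0
  refine ⟨K * Real.exp |A| * ∫ v, ‖k v‖, by positivity, fun t => ?_⟩
  rw [weilConv_apply]
  have hki : Integrable (fun u : ℝ => ‖k (t - u)‖) :=
    ((hk.integrable_of_hasCompactSupport hk').comp_sub_left t).norm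
  have hpt : ∀ u : ℝ, ‖(2 : ℂ) * LagariasMontague.Psic (2 * u) * k (t - u)‖ ≤
      K * Real.exp |A| * Real.exp (-(1 * |t|)) * ‖k (t - u)‖ := by
    intro u
    rw [norm_mul]
    by_cases hu : k (t - u) = 0
    · simp [hu]
    · refine mul_le_mul_of_nonneg_right ?_ (norm_nonneg _)
      have hmem : t - u ∈ Metric.closedBall (0 : ℝ) A := hA (subset_tsupport _ hu)
      rw [Metric.mem_closedBall, dist_zero_right, Real.norm_eq_abs] at hmem
      refine (hΦ u).trans ?_
      rw [mul_assoc, ← Real.exp_add]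
      refine mul_le_mul_of_nonneg_left (Real.exp_le_exp.2 ?_) hK
      have h1 : |t| - |u| ≤ |t - u| := abs_sub_abs_le_abs_sub t u
      have h2 : A ≤ |A| := le_abs_self A
      linarith
  calc ‖∫ u, (2 : ℂ) * LagariasMontague.Psic (2 * u) * k (t - u)‖
      ≤ ∫ u, ‖(2 : ℂ) * LagariasMontague.Psic (2 * u) * k (t - u)‖ :=
        norm_integral_le_integral_norm _
    _ ≤ ∫ u, K * Real.exp |A| * Real.exp (-(1 * |t|)) * ‖k (t - u)‖ :=
        integral_mono_of_nonneg (ae_of_all _ fun u => norm_nonneg _) (hki.const_mul _)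
          (ae_of_all _ hpt)
    _ = K * Real.exp |A| * Real.exp (-(1 * |t|)) * ∫ u, ‖k (t - u)‖ := integral_const_mul _ _
    _ = K * Real.exp |A| * (∫ v, ‖k v‖) * Real.exp (-(1 * |t|)) := by
        rw [integral_sub_left_eq_self (fun v => ‖k v‖) volume t]
        ring

/-! ## Smoothness, derivatives and class bounds of `Φ ⋆ h` for a test function `h` -/

/-- `Φ ⋆ h` is smooth for a test function `h` (`HasCompactSupport.contDiff_convolution_right`).
[folklore] -/
theorem phiConv_contDiff {h : ℝ → ℂ} (hh : IsWeilTest h) :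
    ContDiff ℝ (⊤ : ℕ∞)
      (weilConv (fun t : ℝ => (2 : ℂ) * LagariasMontague.Psic (2 * t)) h) := by
  rw [weilConv_eq_convolution_real]
  exact hh.2.contDiff_convolution_right (ContinuousLinearMap.mul ℝ ℂ)
    continuous_phi.locallyIntegrable hh.1

/-- `(Φ ⋆ h)' = Φ ⋆ h'` and `(Φ ⋆ h)'' = Φ ⋆ h''` for a test function `h`. [folklore] -/
theorem phiConv_deriv {h : ℝ → ℂ} (hh : IsWeilTest h) :
    deriv (weilConv (fun t : ℝ => (2 : ℂ) * LagariasMontague.Psic (2 * t)) h) =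
        weilConv (fun t : ℝ => (2 : ℂ) * LagariasMontague.Psic (2 * t)) (deriv h) ∧
      deriv (deriv (weilConv (fun t : ℝ => (2 : ℂ) * LagariasMontague.Psic (2 * t)) h)) =
        weilConv (fun t : ℝ => (2 : ℂ) * LagariasMontague.Psic (2 * t)) (deriv (deriv h)) := by
  have h1 := ConnesVanSuijlekom.deriv_weilConv_right continuous_phi hh
  exact ⟨h1, by rw [h1, ConnesVanSuijlekom.deriv_weilConv_right continuous_phi hh.deriv]⟩

/-- **Class bounds of `Φ ⋆ h`.** For a test function `h` there is `C` with
`‖Φ ⋆ h‖, ‖(Φ ⋆ h)'‖, ‖(Φ ⋆ h)''‖ ≤ C e^{-|t|}`. [folklore] -/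
theorem phiConv_bounds {h : ℝ → ℂ} (hh : IsWeilTest h) :
    ∃ C : ℝ, ∀ t : ℝ,
      ‖weilConv (fun t : ℝ => (2 : ℂ) * LagariasMontague.Psic (2 * t)) h t‖ ≤
          C * Real.exp (-(1 * |t|)) ∧
      ‖deriv (weilConv (fun t : ℝ => (2 : ℂ) * LagariasMontague.Psic (2 * t)) h) t‖ ≤
          C * Real.exp (-(1 * |t|)) ∧
      ‖deriv (deriv (weilConv (fun t : ℝ => (2 : ℂ) * LagariasMontague.Psic (2 * t)) h)) t‖ ≤
          C * Real.exp (-(1 * |t|)) := by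
  obtain ⟨C₀, hC₀, h₀⟩ := phiConv_norm_weilConv_le hh.1.continuous hh.2
  obtain ⟨C₁, hC₁, h₁⟩ := phiConv_norm_weilConv_le hh.deriv.1.continuous hh.deriv.2
  obtain ⟨C₂, hC₂, h₂⟩ := phiConv_norm_weilConv_le hh.deriv.deriv.1.continuous hh.deriv.deriv.2
  obtain ⟨hd₁, hd₂⟩ := phiConv_deriv hh
  refine ⟨C₀ + C₁ + C₂, fun t => ⟨?_, ?_, ?_⟩⟩
  · exact (h₀ t).trans (mul_le_mul_of_nonneg_right (by linarith) (Real.exp_pos _).le)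
  · rw [hd₁]
    exact (h₁ t).trans (mul_le_mul_of_nonneg_right (by linarith) (Real.exp_pos _).le)
  · rw [hd₂]
    exact (h₂ t).trans (mul_le_mul_of_nonneg_right (by linarith) (Real.exp_pos _).le)

/-! ## The transform of `Φ ⋆ h` -/

/-- **`(Φ ⋆ h)^(s) = ξ(s) ĥ(s)`** for every `s : ℂ` and every continuous compactly supported `h`:
with `c = s - 1/2`, `(Φ ⋆ h)(t) e^{ct} = ((Φ e^{c·}) ⋆ (h e^{c·}))(t)` pointwise, both factors are
integrable (`integrable_phi_mul_cexp` from the exponential moments of `Ψ`), and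
`∫ (G ⋆ H) = (∫ G)(∫ H)` (`MeasureTheory.integral_convolution`); finally `Φ̂ = ξ`
(`stub_mellinXi`). [folklore] -/
theorem phiConv_weilMellin {h : ℝ → ℂ} (hh : Continuous h) (hh' : HasCompactSupport h) (s : ℂ) :
    weilMellin (weilConv (fun t : ℝ => (2 : ℂ) * LagariasMontague.Psic (2 * t)) h) s =
      riemannXi s * weilMellin h s := by
  rw [← stub_mellinXi stub_psiDecay.1 stub_psiDecay.2 s]
  set c : ℂ := s - 1 / 2 with hc
  set G : ℝ → ℂ := fun u => 2 * LagariasMontague.Psic (2 * u) * cexp (c * u) with hG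
  set H : ℝ → ℂ := fun u => h u * cexp (c * u) with hH
  have hGi : Integrable G := integrable_phi_mul_cexp stub_psiDecay.2 s
  have hHi : Integrable H :=
    (hh.mul (by fun_prop)).integrable_of_hasCompactSupport hh'.mul_right
  have key : ∀ t : ℝ,
      weilConv (fun t : ℝ => (2 : ℂ) * LagariasMontague.Psic (2 * t)) h t * cexp (c * t) =
        (G ⋆[ContinuousLinearMap.mul ℂ ℂ] H) t := by
    intro t
    rw [weilConv_apply, convolution_def, ← integral_mul_const]
    congr 1 with u
    simp only [hG, hH, ContinuousLinearMap.mul_apply']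
    have he : cexp (c * t) = cexp (c * u) * cexp (c * ((t - u : ℝ) : ℂ)) := by
      rw [← Complex.exp_add]
      push_cast
      ring_nf
    rw [he]
    ring
  have hL : weilMellin (weilConv (fun t : ℝ => (2 : ℂ) * LagariasMontague.Psic (2 * t)) h) s =
      ∫ t : ℝ, (G ⋆[ContinuousLinearMap.mul ℂ ℂ] H) t := by
    unfold weilMellin
    exact integral_congr_ae (Eventually.of_forall fun t => key t)
  rw [hL, integral_convolution (ContinuousLinearMap.mul ℂ ℂ) hGi hHi,
    ContinuousLinearMap.mul_apply']
  rfl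

/-- `(Φ ⋆ g̃)^(s) = ξ(s) · conj ĝ(1 - conj s)` for a test function `g` and every `s : ℂ`
(`phiConv_weilMellin` and `weilMellin_weilReflect_holds`). [folklore] -/
theorem phiConv_weilMellin_weilReflect {g : ℝ → ℂ} (hg : IsWeilTest g) (s : ℂ) :
    weilMellin (weilConv (fun t : ℝ => (2 : ℂ) * LagariasMontague.Psic (2 * t))
      (weilReflect g)) s = riemannXi s * conj (weilMellin g (1 - conj s)) := by
  rw [phiConv_weilMellin hg.weilReflect.1.continuous hg.weilReflect.2, weilMellin_weilReflect_holds]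

/-! ## The stub -/

/-- **Stub W14 — `phi_conv_harmonic` (RH-free; takes the class explicit formula (EF) as
hypothesis).** For every Weil test function `g`, `Φ ⋆ g̃` lies in the exponential Weil class
(smooth: `HasCompactSupport.contDiff_convolution_right`; `(Φ ⋆ g̃)^{(j)} = Φ ⋆ (g̃)^{(j)}` and
`‖(Φ ⋆ k)(t)‖ ≤ K e^{A} e^{-|t|} ∫ ‖k‖` from the envelope of `Φ`), its transform is
`ξ(s) · conj ĝ(1 - conj s)` (Fubini via `MeasureTheory.integral_convolution`;
`weilMellin_weilReflect_holds`), which vanishes at every non-trivial zero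
(`riemannXi_eq_zero_of_mem_riemannZetaNontrivialZeros`), hence by (EF)
**`W(Φ ⋆ g̃) = Σ'_ρ m(ρ) (Φ ⋆ g̃)^(ρ) = 0`**: Riemann's kernel is Weil-harmonic. [folklore] -/
theorem stub_phi_conv_harmonic :
    (∀ (f : ℝ → ℂ) (C b₀ : ℝ), ContDiff ℝ (⊤ : ℕ∞) f → 1 / 2 < b₀ →
      (∀ t, ‖f t‖ ≤ C * Real.exp (-(b₀ * |t|))) →
      (∀ t, ‖deriv f t‖ ≤ C * Real.exp (-(b₀ * |t|))) →
      (∀ t, ‖deriv (deriv f) t‖ ≤ C * Real.exp (-(b₀ * |t|))) →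
      Summable (fun ρ : ZetaZeros.riemannZetaNontrivialZeros =>
          ‖(riemannZetaZeroOrder (ρ : ℂ) : ℂ) * weilMellin f ρ‖) ∧
      ∑' ρ : ZetaZeros.riemannZetaNontrivialZeros,
          (riemannZetaZeroOrder (ρ : ℂ) : ℂ) * weilMellin f ρ = weilFunctional f) →
    ∀ g : ℝ → ℂ, IsWeilTest g →
      (∀ s : ℂ, 0 ≤ s.re → s.re ≤ 1 →
        weilMellin (weilConv (fun t : ℝ => (2 : ℂ) * LagariasMontague.Psic (2 * t))
          (weilReflect g)) s = riemannXi s * (starRingEnd ℂ) (weilMellin g (1 - (starRingEnd ℂ) s))) ∧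
      weilFunctional (weilConv (fun t : ℝ => (2 : ℂ) * LagariasMontague.Psic (2 * t))
        (weilReflect g)) = 0 := by
  intro hEF g hg
  refine ⟨fun s _ _ => phiConv_weilMellin_weilReflect hg s, ?_⟩
  obtain ⟨C, hC⟩ := phiConv_bounds hg.weilReflect
  obtain ⟨-, hsum⟩ := hEF
    (weilConv (fun t : ℝ => (2 : ℂ) * LagariasMontague.Psic (2 * t)) (weilReflect g)) C 1
    (phiConv_contDiff hg.weilReflect) (by norm_num) (fun t => (hC t).1) (fun t => (hC t).2.1)
    (fun t => (hC t).2.2)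
  rw [← hsum]
  refine (tsum_congr fun ρ => ?_).trans tsum_zero
  rw [phiConv_weilMellin_weilReflect hg, riemannXi_eq_zero_of_mem_riemannZetaNontrivialZeros ρ.2,
    zero_mul, mul_zero]

end Summit.RiemannHypothesis.RiemannHypothesis.Theorems.GroundStatesConvergeToXi

end
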